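import Mathlib.Analysis.SpecialFunctions.Stirling
import Mathlib.Analysis.Asymptotics.Lemmas
import HarnessLib

/-!
# Exponential rate of the factorial ratio `(2n)!³ / ((3n+1)!)²`

Topic `Literature/NumberTheory/DiophantineApproximation`. Everything in this file is PROVED.

The quantity `R_n(2n+1) = (2n)! · ((2n)! / (3n+1)!)² = (2n)!³ / ((3n+1)!)²` is the first
non-vanishing coefficient of the type-I Hermite–Padé forms `S_n = ∑_{t ≥ 1} R_n(t) x^t` used for
the linear independence of `1, Li₁(1/N), Li₂(1/N)`; its exponential decay rate enters the threshold
`N₀` of that result. We prove the sharp rate: for every `ε > 0`,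

  `exp (-(6 log (3/2) + ε) n) ≤ (2n)!³ / ((3n+1)!)²`  for all large `n`

(`eventually_exp_le_factorial_ratio`), i.e. the rate is `6 log (3/2) = 2.43…`.

Proof: Stirling's formula via Mathlib. The lower bound
`n log n - n ≤ log n!` is `Stirling.le_log_factorial_stirling` (dropping non-negative terms); the
upper bound `log m! ≤ m log m - m + (log m)/2 + 1` for `m ≥ 1` (`log_factorial_succ_le`) follows from
the antitonicity of `log ∘ stirlingSeq ∘ succ` (`Stirling.log_stirlingSeq'_antitone`) and
`stirlingSeq 1 = e / √2`. With `a = 2n`, `b = 3n + 1` this gives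
`log ((2n)!³/((3n+1)!)²) ≥ 6n log (2n) - 6n log (3n+1) - 3 log (3n+1)`, and
`log (3n+1) - log (2n) - log (3/2) = log (1 + 1/(3n)) ≤ 1/(3n)` bounds the first two terms below by
`-6 n log (3/2) - 2`; finally `2 + 3 log (3n+1) ≤ ε n` eventually (`log = o(id)`).

What is NOT here: the matching upper bound (the rate is exact), and any effective threshold.
-/

namespace Literature.NumberTheory.DiophantineApproximation

open _root_.Filter _root_.Topology _root_.Asymptotics Real

/-- **Upper Stirling bound in logarithmic form.** For every `k : ℕ`,
`log (k+1)! ≤ (k+1) log (k+1) - (k+1) + log (k+1) / 2 + 1`, i.e. `m! ≤ e √m (m/e)^m` for `m ≥ 1`;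
a consequence of the antitonicity of Stirling's sequence `m! / (√(2m) (m/e)^m)` on `m ≥ 1` and its
value `e/√2` at `m = 1`. [folklore] -/
theorem log_factorial_succ_le (k : ℕ) :
    Real.log ((k + 1).factorial : ℝ) ≤
      ((k : ℝ) + 1) * Real.log ((k : ℝ) + 1) - ((k : ℝ) + 1) + Real.log ((k : ℝ) + 1) / 2 + 1 := by
  have h1 : Real.log (Stirling.stirlingSeq (k + 1)) ≤ Real.log (Stirling.stirlingSeq (0 + 1)) :=
    Stirling.log_stirlingSeq'_antitone (Nat.zero_le k)
  rw [zero_add, Stirling.stirlingSeq_one, Stirling.log_stirlingSeq_formula,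
    Real.log_div (Real.exp_pos 1).ne' (by positivity), Real.log_exp,
    Real.log_sqrt zero_le_two] at h1
  have hk : (0 : ℝ) < (k : ℝ) + 1 := by positivity
  push_cast at h1
  rw [Real.log_mul two_ne_zero hk.ne', Real.log_div hk.ne' (Real.exp_pos 1).ne',
    Real.log_exp] at h1
  linarith

/-- **Exponential rate of `(2n)!³ / ((3n+1)!)²` (sharp form).** For every `ε > 0`, eventually in
`n`, `exp (-(6 log (3/2) + ε) n) ≤ (2n)!³ / ((3n+1)!)²`. This is the decay rate of the leading
coefficient `R_n(2n+1)` of the Hermite–Padé forms for `1, Li₁, Li₂`; it follows from Stirling's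
formula (`Stirling.le_log_factorial_stirling`, `log_factorial_succ_le`) and `log x = o(x)`.
[folklore] -/
theorem eventually_exp_le_factorial_ratio {ε : ℝ} (hε : 0 < ε) :
    ∀ᶠ n : ℕ in Filter.atTop,
      Real.exp (-((6 * Real.log (3 / 2) + ε) * n)) ≤
        ((2 * n).factorial : ℝ) ^ 3 / (((3 * n + 1).factorial : ℝ) ^ 2) := by
  -- (1) the sub-linear loss `2 + 3 log (3n+1)` is eventually at most `ε n`
  have hlog : ∀ᶠ n : ℕ in atTop, 2 + 3 * Real.log (3 * (n : ℝ) + 1) ≤ ε * n := by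
    have h1 : ∀ᶠ n : ℕ in atTop, ‖Real.log (n : ℝ)‖ ≤ ε / 6 * ‖id (n : ℝ)‖ :=
      Real.isLittleO_log_id_atTop.natCast_atTop.bound (by positivity)
    have h2 : ∀ᶠ n : ℕ in atTop, (4 + 6 * Real.log 4) / ε ≤ (n : ℝ) :=
      tendsto_natCast_atTop_atTop.eventually_ge_atTop _
    filter_upwards [h1, h2, eventually_ge_atTop 1] with n hn1 hn2 hn3
    have hn : (1 : ℝ) ≤ n := by exact_mod_cast hn3
    rw [id, Real.norm_eq_abs, Real.norm_eq_abs, abs_of_nonneg (Real.log_nonneg hn),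
      abs_of_nonneg (zero_le_one.trans hn)] at hn1
    have h4 : Real.log (3 * (n : ℝ) + 1) ≤ Real.log 4 + Real.log n := by
      rw [← Real.log_mul (by norm_num) (by positivity)]
      exact Real.log_le_log (by positivity) (by linarith)
    have h5 : 4 + 6 * Real.log 4 ≤ (n : ℝ) * ε := (div_le_iff₀ hε).mp hn2
    linarith
  -- (2) the main estimate, for `n ≥ 1` with (1)
  filter_upwards [hlog, eventually_ge_atTop 1] with n hn hn1
  have hn0 : (1 : ℝ) ≤ n := by exact_mod_cast hn1
  -- Stirling from below for `(2n)!`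
  have hA : 2 * n * Real.log (2 * n) - 2 * n ≤ Real.log ((2 * n).factorial : ℝ) := by
    have h := Stirling.le_log_factorial_stirling (n := 2 * n) (by omega)
    push_cast at h
    have h1 : 0 ≤ Real.log (2 * n) := Real.log_nonneg (by linarith)
    have h2 : 0 ≤ Real.log (2 * π) := Real.log_nonneg (by linarith [Real.two_le_pi])
    linarith
  -- Stirling from above for `(3n+1)!`
  have hB : Real.log ((3 * n + 1).factorial : ℝ) ≤
      (3 * n + 1) * Real.log (3 * n + 1) - (3 * n + 1) + Real.log (3 * n + 1) / 2 + 1 := by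
    have h := log_factorial_succ_le (3 * n)
    push_cast at h
    exact h
  -- `log (3n+1) - log (2n) - log (3/2) = log (1 + 1/(3n)) ≤ 1/(3n)`
  have hkey : Real.log (3 * n + 1) ≤ Real.log (2 * n) + Real.log (3 / 2) + 1 / (3 * n) := by
    have h1 : Real.log ((3 * n + 1) / (3 * n)) ≤ (3 * n + 1) / (3 * n) - 1 :=
      Real.log_le_sub_one_of_pos (by positivity)
    have h2 : Real.log ((3 * n + 1) / (3 * n)) =
        Real.log (3 * n + 1) - (Real.log (2 * n) + Real.log (3 / 2)) := by
      have e : 2 * (n : ℝ) * (3 / 2) = 3 * n := by ring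
      rw [← Real.log_mul (by positivity : (2 * (n : ℝ)) ≠ 0) (by norm_num : (3 / 2 : ℝ) ≠ 0), e,
        Real.log_div (by positivity : (3 * (n : ℝ) + 1) ≠ 0) (by positivity : (3 * (n : ℝ)) ≠ 0)]
    have h3 : (3 * (n : ℝ) + 1) / (3 * n) - 1 = 1 / (3 * n) := by
      field_simp
      ring
    linarith
  have h6 : 6 * n * Real.log (3 * n + 1) ≤
      6 * n * Real.log (2 * n) + 6 * n * Real.log (3 / 2) + 2 := by
    have h := mul_le_mul_of_nonneg_left hkey (by positivity : (0 : ℝ) ≤ 6 * n)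
    have e : 6 * n * (1 / (3 * (n : ℝ))) = 2 := by
      field_simp
      ring
    linarith
  -- combine in logarithmic form
  have hR : -((6 * Real.log (3 / 2) + ε) * n) ≤
      3 * Real.log ((2 * n).factorial : ℝ) - 2 * Real.log ((3 * n + 1).factorial : ℝ) := by
    linarith
  have hApos : (0 : ℝ) < (2 * n).factorial := by exact_mod_cast Nat.factorial_pos _
  have hBpos : (0 : ℝ) < (3 * n + 1).factorial := by exact_mod_cast Nat.factorial_pos _
  rw [← Real.exp_log (by positivity :
      (0 : ℝ) < ((2 * n).factorial : ℝ) ^ 3 / ((3 * n + 1).factorial : ℝ) ^ 2),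
    Real.exp_le_exp, Real.log_div (pow_pos hApos 3).ne' (pow_pos hBpos 2).ne', Real.log_pow,
    Real.log_pow]
  push_cast
  linarith

end Literature.NumberTheory.DiophantineApproximation
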